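import Summits.BirchSwinnertonDyer.BirchSwinnertonDyer.Theorems.PrintCFramJZeroThreeTraceFormBadPrimes
import Summits.BirchSwinnertonDyer.BirchSwinnertonDyer.Theorems.PrintCFramJZeroThreeUnitRegimePrimePairBernoulli
import Summits.BirchSwinnertonDyer.Rank1Residual.X12.JZeroThreeUnitRegime
import HarnessLib

/-! # K12r@3 — the «3-unit regime» CLASS THEOREM for a PRIME PAIR `(q, −r)`: BSD(W, 3) for every
# globally minimal `W ≅ y² = x³ + q·m²` of analytic rank one, `ψ = (·/q)` (`q ≡ 1 (mod 4)` prime,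
# `(3/q) = −1`), Heegner field `K = ℚ(√−r)` (`r ≡ 3 (mod 4)` prime, `3` and `q` split), from
# Kriz–Li Thm. 1.20 + Rem. 3.10 (ROUTE U at `p = 3`) with every character binder discharged MODULO
# the two integer certificates `3 ∤ S₁(q,r)`, `3 ∥ S₂(q)` of `…PrimePairBernoulli` (cell
# `bsd-print-cfram`, seat p3 g2; regime N = `TorsionFreeFrameBSDThree`, stmt-BirchSwinnertonDyer-20698;
# instances: `(5,−11)` = p546876 [225a 675a 6075a/b/c], `(17,−47)` [7803a/b/c], `(41,−23)` [15129a],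
# `(5,−59)` [11025a/b])

HONEST FRAMING (cell `bsd-print-cfram`, run/shared/lean/pub/bsd-print-cfram/, D-0131 (2) print
tier; verbatim in every file of the cell): the cell works the partition leaf
`CornerF ∧ p ramified in the CM field K` (LADDER-BSD row K7r = B13; W-ALL row 12r) in PARTITION
currency — a leaf or a cell counts only when its theorem is in the kernel BY NAME. Nothing here is a
Literature statement, no named fact is introduced, nothing is asserted about BSD; beyond-print: NO
(Kriz–Li 2019 §10.3's mechanism at `p = 3`; the classes served are outside the printed `E_d` family of
Thm. 1.23 but inside Thm. 1.20's reach — P3-UNIT-REGIME-CENSUS §0; all lie in regime N of the C1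
split, HOME/plan, criterion p546152).

**`bsdp_three_of_unitRegime_prime_pair`** = seat p4's `JZeroThree.bsdp_three_of_thm120_unitRegime`
(ROUTE U: Kriz–Li Thm. 1.20 `hKL` ∧ Rem. 3.10 `hRem` + Gross–Zagier + Kolyvagin + GZK + modularity +
the twin's `3`-part + descent inputs, at `p = 3`, `j = 0`) with `ψ = χ_q = (·/q)`, `K` of
discriminant `−r`, `ε_K = (·/r)↑`, and the binders `hψ` (primitive), `hss` (the trace form,
`PrintCFram.hss_three_of_mordell_int`), (1) `h1a`/`h1b`, (3) `h3`, `hHN`, `hd4`, `hεK`, `hB`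
discharged from DECIDABLE numerics that each instance supplies by `decide`/`norm_num`:
`q % 4 = 1`, `r % 4 = 3`, `r ≠ 3`, `J(3 | q) = −1` (KL (1): `ψ(3) = (3/q)`), `J(−r | 3) = J(−r | q) = 1`
(`3`, `q` split in `K`), the two certificates, and the bad-prime clause `hS`: every bad `ℓ` is `3`,
`q`, or a prime `ℓ ≡ 1 (mod 3)` with `J(ℓ | q) = −1` and `J(−r | ℓ) = 1` (KL (3) there: `ψ(ℓ) = −1`,
`(ψ⁻¹ω)(ℓ) = −(ℓ/3) = −1`; `ℓ` split in `K`) — e.g. `ℓ = 7` for `11025a/b` (`(7/5) = −1`,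
`(−59/7) = 1`). What REMAINS displayed is exactly Route U's non-character telescope (as in
`…UnitRegimeFiveEleven`): the Heegner/parametrisation DATA `(D, H, ι, ιp, P, hP)`, the PUB facts
(`hGZ`, `hKo`, `hGZK`, `hmod`), `r_an = 1`, `L(W^{(−r)}, 1) ≠ 0`, the twin `Wd` with `htw`
(Burungale–Flach, the caller's) and `htam`/`hu`, the certificate binders `htamW` (`3 ∤ ∏c_ℓ`),
`hSW`/`hSd` (`3 ∤ #Ш`), the level-`0` generator `g` (`hg0`, `hiv`, `crd`), and the model one-liners
`hW`/`h6` (`C • W = y² = x³ + qm²`, sixth-power-free), `h2` (`a₂(W) = 0` if good at `2`), `hS`.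
PER CLASS in its binders, nothing booked; a display record in the regime has NO transcendental input.
References: [KrizLi2019] Thm. 1.20 (pp. 7–8), Rem. 3.10 (p. 26), Thm. 1.23, §10.3;
[GrossZagier1986] V.§2; [Miller2011LMS] Def. 1.1; [Cox2013] §1.C Lemma 1.14;
`X12/JZeroThreeUnitRegime.lean` (p4), `X12/O11/RouteUMember11.lean` (bsd-cm, the `p = 7` pattern).
-/

set_option linter.dupNamespace false
set_option autoImplicit false

noncomputable section

open scoped Classical
open NumberField Field WeierstrassCurve DirichletCharacter
open Literature.NumberTheory.EllipticCurves Literature.NumberTheory.EllipticCurves.KrizLi2019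
  Literature.NumberTheory.EllipticCurves.ModularForms Literature.NumberTheory.QuadraticFields
  Summit.BirchSwinnertonDyer.Rank1Residual.X12.O11.RouteU

namespace Summit.BirchSwinnertonDyer.BirchSwinnertonDyer.Theorems.PrintCFram

/-! ## §4 The class theorem for a prime pair `(q, −r)` -/

/-- **`ℓ` splits in a quadratic field of discriminant `−r` when `J(−r | ℓ) = 1`** (`ℓ` an odd prime;
decomposition law). [cite: Cox2013, §1.C Lemma 1.14] -/
theorem ncard_primesOver_eq_two_of_jacobiSym_neg {K : Type} [Field K] [NumberField K]
    (hK2 : Module.finrank ℚ K = 2) {r : ℕ} (hdK : NumberField.discr K = -(r : ℤ)) {ℓ : ℕ}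
    (hℓ : ℓ.Prime) (hℓ2 : ℓ ≠ 2) (hJ : jacobiSym (-(r : ℤ)) ℓ = 1) :
    ((Ideal.span {(ℓ : ℤ)}).primesOver (𝓞 K)).ncard = 2 := by
  haveI := Fact.mk hℓ
  rw [Quadratic.ncard_primesOver_eq_two_iff_legendreSym hK2 hℓ2, hdK,
    jacobiSym.legendreSym.to_jacobiSym]
  exact hJ

/-- **BSD(W, 3) in the 3-UNIT REGIME for a PRIME PAIR `(q, −r)`** — for primes `q ≡ 1 (mod 4)` with
`J(3 | q) = −1` (Kriz–Li (1): `ψ(3) = (3/q) ≠ 1`) and `r ≡ 3 (mod 4)`, `r ≠ 3`, with `3` and `q`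
split in `K = ℚ(√−r)` (`J(−r | 3) = J(−r | q) = 1`) and the two integer certificates
`3 ∤ S₁ = Σ_{j<qr} (j/q)(j/r)·j`, `3 ∥ S₂ = Σ_{j<3q} (j/q)(j/3)·j` (the Bernoulli-unit hypothesis):
for every globally minimal `W/ℚ` of analytic rank one with `C • W = y² = x³ + q·m²` (`m ∈ ℤ`, `qm²`
sixth-power-free), `a₂(W) = 0` if `W` is good at `2`, every bad prime `ℓ` equal to `3`, `q`, or a
prime `ℓ ≡ 1 (mod 3)` with `J(ℓ | q) = −1`, `J(−r | ℓ) = 1` (KL (3) + Heegner at `ℓ`), and `K` of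
discriminant `−r`: ROUTE U at `p = 3` (`JZeroThree.bsdp_three_of_thm120_unitRegime`, p4) with
`ψ = (·/q)`, `ε_K = (·/r)↑` and every character / trace-form / splitting / Bernoulli binder
discharged; the displayed binders are Route U's data, PUB facts and certificates (module docstring).
Instance `(5, −11)` is `bsdp_three_of_unitRegime_five_eleven` (p546876).
[cite: KrizLi2019, Thm. 1.20 (pp. 7–8), Rem. 3.10 (p. 26), §10.3]
[cite: GrossZagier1986, V.§2 (pp. 310–312)] [cite: Miller2011LMS, Def. 1.1] -/
theorem bsdp_three_of_unitRegime_prime_pair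
    (hKL : KrizLi2019.thm120_padicLogHeegner_unit_of_bernoulli)
    (hRem : KrizLi2019.rem310_padicLogHeegner_integral)
    -- the prime pair and its decidable numerics
    {q r : ℕ} [hq : Fact q.Prime] [hrp : Fact r.Prime] (hq4 : q % 4 = 1) (hr4 : r % 4 = 3)
    (hr3 : r ≠ 3) (h1 : jacobiSym 3 q = -1)
    (hs3 : jacobiSym (-(r : ℤ)) 3 = 1) (hsq : jacobiSym (-(r : ℤ)) q = 1)
    (hS₁ : ¬ ((3 : ℤ) ∣ ∑ j ∈ Finset.range (q * r),
      legendreSym q (j : ℤ) * legendreSym r (j : ℤ) * (j : ℤ)))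
    (hS₂ : (3 : ℤ) ∣ ∑ j ∈ Finset.range (q * 3),
      legendreSym q (j : ℤ) * legendreSym 3 (j : ℤ) * (j : ℤ) ^ (0 + 1))
    (hS₂' : ¬ ((3 : ℤ) ^ 2 ∣ ∑ j ∈ Finset.range (q * 3),
      legendreSym q (j : ℤ) * legendreSym 3 (j : ℤ) * (j : ℤ) ^ (0 + 1)))
    (W : WeierstrassCurve ℚ) [W.IsElliptic] [W.IsGloballyMinimal] [NeZero (W.conductorNorm ℤ)]
    -- the Mordell datum and the three per-curve one-liners
    {m : ℤ} (hm : m ≠ 0) (hW : ∃ C : VariableChange ℚ, C • W = mordellCurve ((q : ℚ) * (m : ℚ) ^ 2))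
    (h6 : ∀ ℓ : ℕ, ℓ.Prime → ¬ ((ℓ : ℤ) ^ 6 ∣ (q : ℤ) * m ^ 2))
    (h2 : (haveI : Fact (Nat.Prime 2) := ⟨Nat.prime_two⟩; W.HasGoodReductionAtPrime 2) →
      W.LFunction 2 = 0)
    (hS : ∀ ℓ : ℕ, (hℓ : ℓ.Prime) → ¬ (haveI := Fact.mk hℓ; W.HasGoodReductionAtPrime ℓ) →
      ℓ = 3 ∨ ℓ = q ∨ (ℓ % 3 = 1 ∧ jacobiSym (ℓ : ℤ) q = -1 ∧ jacobiSym (-(r : ℤ)) ℓ = 1))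
    -- the Heegner field `ℚ(√−r)` and Route U's data / PUB facts
    (K : Type) [Field K] [NumberField K] [NeZero (NumberField.discr K).natAbs]
    (hK : IsImaginaryQuadratic K) (hdK : NumberField.discr K = -(r : ℤ))
    (D : ModularParametrizationData W (W.conductorNorm ℤ))
    (H : HeegnerDatum (W.conductorNorm ℤ) (NumberField.discr K)) (ι : K →+* ℂ)
    (ιp : K →+* ℚ_[3]) (P : (W.baseChange K).toAffine.Point)
    (hGZ : gross_zagier (W.conductorNorm ℤ) W K) (hKo : kolyvagin (W.conductorNorm ℤ) W K)
    (hGZK : rank_eq_analyticRank_of_analyticRank_le_one) (hmod : hasEntireLFunction_rat)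
    (hP : WeierstrassCurve.Affine.Point.map ι.toRatAlgHom P = heegnerPointComplex D H)
    (hr : W.analyticRank = 1)
    (hLt : (W.quadraticTwist (NumberField.discr K : ℚ)).entireLFunction 1 ≠ 0)
    (Wd : WeierstrassCurve ℚ) [Wd.IsElliptic] [Wd.IsGloballyMinimal] (Cd : VariableChange ℚ)
    (hWd : Cd • W.quadraticTwist (NumberField.discr K : ℚ) = Wd)
    (htw : ∃ q : ℚ, Wd.entireLFunction 1 / (Wd.realPeriodRat : ℂ) = (q : ℂ) ∧
      padicValRat 3 q = (padicValNat 3 Wd.shaOrder : ℤ) + padicValNat 3 Wd.tamagawaProduct -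
        2 * padicValNat 3 Wd.torsionOrder)
    (htam : padicValNat 3 Wd.tamagawaProduct = padicValNat 3 W.tamagawaProduct)
    (hu : padicValRat 3 (Cd.u : ℚ) = 0)
    (htamW : ¬ 3 ∣ W.tamagawaProduct)
    (hSW : ∀ [Finite W.sha], ¬ 3 ∣ W.shaOrder) (hSd : ∀ [Finite Wd.sha], ¬ 3 ∣ Wd.shaOrder)
    -- a Teichmüller character mod 3 and T-U2's level-0 generator data
    (ω : DirichletCharacter ℚ_[3] 3) (hω : KrizLi2019.IsTeichmullerCharacter ω)
    [Finite (AddCommGroup.torsion (W.baseChange K).toAffine.Point)]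
    (crd : (W.baseChange K).toAffine.Point →+ ℤ) (g : (W.baseChange K).toAffine.Point)
    (hg : crd g = 1) (hker : ∀ x, crd x = 0 → IsOfFinAddOrder x)
    (hiv : ∀ x : (W.baseChange K).toAffine.Point, 3 • x = 0 → x = 0)
    (hg0 : ‖Castella2018.padicLogOmega W 3 ιp g‖ = 1) :
    BSDp W 3 := by
  haveI : NeZero q := ⟨hq.out.ne_zero⟩
  have hq2 : q ≠ 2 := by omega
  have hr2 : r ≠ 2 := by omega
  have hq3 : q ≠ 3 := by
    rintro rfl
    rw [jacobiSym.eq_zero_iff.mpr ⟨by norm_num, by decide⟩] at h1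
    norm_num at h1
  have hqr : q ≠ r := by omega
  -- the characters `ψ = (·/q)`, `ε = (·/r)`, `ε_K = ε↑`
  obtain ⟨χq, hχq⟩ := exists_legendreCharacter_three q
  obtain ⟨χr, hχr⟩ := exists_legendreCharacter_three r
  have hrd : r ∣ (NumberField.discr K).natAbs := by rw [hdK, Int.natAbs_neg, Int.natAbs_natCast]
  have hne : χq ≠ 1 := legendreChar_three_ne_one χq hχq hq2
  have hωne : ω ≠ 1 := ne_one_of_isTeichmullerCharacter (p := 3) (by norm_num) hω
  -- `j(W) = 0`
  have hj : W.j = 0 := by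
    obtain ⟨C, hC⟩ := hW
    have hc4 : (C • W).c₄ = 0 := by rw [hC, mordellCurve_c₄]
    have h1' : (C • W).j = W.j := variableChange_j W C
    have h2' : (C • W).j = 0 := by rw [WeierstrassCurve.j, hc4]; simp
    rw [← h1', h2']
  -- the Mordell datum in the `(d, m)` currency of the trace-form files
  have hW' : ∃ C : VariableChange ℚ, C • W = mordellCurve (((q : ℤ) : ℚ) * (m : ℚ) ^ 2) := by
    simpa using hW
  have hsf : Squarefree (q : ℤ) := by
    rw [Int.squarefree_natCast]; exact hq.out.squarefree
  -- `hss` (`ψ(ℓ) = J(q | ℓ)` at every odd prime `ℓ` by reciprocity, `q ≡ 1 (mod 4)`)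
  have hss := hss_three_of_mordell_int W hsf hm hW' h6 h2 χq ω hω
    (legendreChar_three_mul_self χq hχq) (fun ℓ hℓ _ hℓ1 => by
      have := legendreChar_three_apply_prime_eq_jacobiSym χq hχq hq4 hℓ (by omega)
      simpa using this)
  -- the Heegner hypothesis: every bad prime is `3`, `q` or a listed `ℓ`, all split in `ℚ(√−r)`
  have hHN : SatisfiesHeegnerHypothesis (W.conductorNorm ℤ) K := by
    intro p hp hpN
    haveI := Fact.mk hp
    have hbad : ¬ W.HasGoodReductionAtPrime p := fun hgood =>
      not_dvd_conductorNorm_of_hasGoodReductionAtPrime W hgood hpN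
    rcases hS p hp hbad with h3 | hq' | ⟨hp1, -, hJ⟩
    · rw [h3] at hp ⊢
      exact ncard_primesOver_eq_two_of_jacobiSym_neg hK.1 hdK hp (by norm_num) hs3
    · rw [hq'] at hp ⊢
      exact ncard_primesOver_eq_two_of_jacobiSym_neg hK.1 hdK hp hq2 hsq
    · exact ncard_primesOver_eq_two_of_jacobiSym_neg hK.1 hdK hp (by omega) hJ
  -- (1a): `ψ(3) = (3/q) = J(3 | q) = −1`
  have h1a : χq (3 : ZMod q) ≠ 1 := by
    refine legendreChar_three_apply_three_ne_one χq hχq ?_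
    rw [jacobiSym.legendreSym.to_jacobiSym]; exact h1
  refine Rank1Residual.X12.JZeroThree.bsdp_three_of_thm120_unitRegime hKL hRem W hj K D H ι ιp P hGZ
    hKo hGZK hmod hK (by rw [hdK]; have := hrp.out.two_le; omega) hHN hP hr hLt Wd Cd hWd htw htam hu
    htamW hSW hSd q χq ω (legendreChar_three_isPrimitive χq hχq hq2) hω hss h1a
    (primVal_invMulOmega_ne_one_of_prime_level hq3 χq hne ω hωne (Or.inr (dvd_refl 3)))
    (fun ℓ hℓ hℓ3 hbad => ?_) (changeLevel hrd χr) (isKroneckerCharacterOf_legendre hr4 hK.1 hdK χr hχr hrd)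
    (bernoulli_hypothesis_prime_pair hq4 hr2 hqr hq3 hr3 hrd χq hχq χr hχr ω hω hS₁ hS₂ hS₂')
    crd g hg hker hiv hg0
  -- (3) at the additive primes `ℓ ≠ 3`
  rcases hS ℓ hℓ hbad.1 with h3 | hq' | ⟨hℓ1, hJq, -⟩
  · exact absurd h3 hℓ3
  · -- `ℓ = q`: both characters vanish
    rw [hq']
    exact ⟨legendreChar_three_apply_ne_one_of_dvd χq hχq (dvd_refl q),
      primVal_invMulOmega_ne_one_of_prime_level hq3 χq hne ω hωne (Or.inl (dvd_refl q))⟩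
  · -- a listed `ℓ ≡ 1 (mod 3)` with `(ℓ/q) = −1`: `ψ(ℓ) = −1`, `(ψ⁻¹ω)(ℓ) = −(ℓ/3) = −1`
    have hℓq : ℓ ≠ q := by
      intro he
      rw [he, jacobiSym.mod_left, Int.emod_self, jacobiSym.zero_left hq.out.one_lt] at hJq
      norm_num at hJq
    have hval : χq (ℓ : ZMod q) = -1 := by
      rw [hχq, jacobiSym.legendreSym.to_jacobiSym, hJq]; norm_num
    have hω1 : ω (ℓ : ZMod 3) = 1 := by
      have := teichmuller_three_apply_of_emod_eq_one hω (ℓ : ℤ) (by exact_mod_cast hℓ1)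
      simpa [Int.cast_natCast] using this
    have hcop : ℓ.Coprime (q * 3) := Nat.Coprime.mul_right
      ((Nat.coprime_primes hℓ hq.out).mpr hℓq) ((Nat.coprime_primes hℓ Nat.prime_three).mpr hℓ3)
    have hinv : χq⁻¹ = χq := inv_eq_of_mul_eq_one_right (legendreChar_three_mul_self χq hχq)
    refine ⟨by rw [hval]; norm_num, ?_⟩
    rw [primVal_invMulOmega_of_coprime χq ω hcop, hinv, hval, hω1]
    norm_num

end Summit.BirchSwinnertonDyer.BirchSwinnertonDyer.Theorems.PrintCFram

end
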